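import Summits.RiemannHypothesis.RiemannHypothesis.Theses.Fences

/-!
# `StepFromInverse` — the budget bookkeeping of the BC2 redirect of `Fences.ClusterForcing`

Route item stmt-RiemannHypothesis-17860
(`Fences.StepFromInverse : TwoSidedPowerSum → LocalZeroPowerSum → ZeroChainStep`),
crux-strategist r1 (2026-08-17). PROOF: one application of the budgeted two-sided inverse theorem
to the local power sum at a zero `ρ` (depth `d` below a near-apex zero `ρ₀`), with
`A = log T/loglog T`, budget `B = C_L (log T)^5 e^{2Ad}`, `a = 2K`, `b = 6K`,
`D = min(η, η/(8C), 1/(8KC_L))`; the thresholds on `ℓ = loglog T` are explicit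
(`x^k/k! ≤ eˣ` for `k = 2, 3, 4`). No ζ-theory beyond `ζ ≠ 0` on `Re s ≥ 1`.
-/

namespace Summit.RiemannHypothesis.RiemannHypothesis.Theorems

open Summit.RiemannHypothesis.RiemannHypothesis.Theses.Fences

theorem sfi_sq_div_two_le_exp {x : ℝ} (hx : 0 ≤ x) : x ^ 2 / 2 ≤ Real.exp x := by
  have h := Real.pow_div_factorial_le_exp x hx 2
  have h2 : (Nat.factorial 2 : ℝ) = 2 := by norm_num [Nat.factorial]
  rw [h2] at h
  exact h

theorem sfi_cube_div_six_le_exp {x : ℝ} (hx : 0 ≤ x) : x ^ 3 / 6 ≤ Real.exp x := by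
  have h := Real.pow_div_factorial_le_exp x hx 3
  have h3 : (Nat.factorial 3 : ℝ) = 6 := by norm_num [Nat.factorial]
  rw [h3] at h
  exact h

theorem sfi_pow_four_div_le_exp {x : ℝ} (hx : 0 ≤ x) : x ^ 4 / 24 ≤ Real.exp x := by
  have h := Real.pow_div_factorial_le_exp x hx 4
  have h4 : (Nat.factorial 4 : ℝ) = 24 := by norm_num [Nat.factorial]
  rw [h4] at h
  exact h

set_option maxHeartbeats 1000000 in
/-- The smallness bookkeeping: `C_L((L³+1)e^{−Aη} + e^{−L/4}) ≤ B^{−C}` with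
`log B = log C_L + 5ℓ + 2Ad`, under explicit thresholds on `ℓ = log L`. [folklore] -/
theorem sfi_smallness {C CL η ℓ L A d Q₁ Q₂ : ℝ} (hC : 0 < C) (hCL : 0 < CL) (hη : 0 < η)
    (hℓ1 : 1 ≤ ℓ) (hℓη : 2 * η ≤ ℓ)
    (hQ₁def : Real.log (2 * CL) + Real.log 2 + C * Real.log CL ≤ Q₁)
    (hQ₂def : Real.log 2 + Real.log CL + C * Real.log CL ≤ Q₂)
    (hℓQ₁ : 64 * Q₁ / η ≤ ℓ) (hℓC : 64 * (3 + 5 * C) / η ≤ ℓ) (hℓQ₂ : 32 * Q₂ ≤ ℓ)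
    (hℓ160 : 160 * C ≤ ℓ) (hL : L = Real.exp ℓ) (hA : A = L / ℓ) (hd : 2 * A * C * d ≤ A * η / 4) :
    CL * ((L ^ 3 + 1) * Real.exp (-(A * η)) + Real.exp (-(L / 4))) ≤
      Real.exp (-(C * (Real.log CL + 5 * ℓ + 2 * A * d))) := by
  have hℓpos : 0 < ℓ := by linarith
  have hLpos : 0 < L := by rw [hL]; exact Real.exp_pos _
  have hL1 : 1 ≤ L := by rw [hL]; have := Real.add_one_le_exp ℓ; linarith
  have hApos : 0 < A := by rw [hA]; positivity
  set E₀ : ℝ := -(C * Real.log CL) - 5 * C * ℓ - A * η / 4 with hE₀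
  have htarget : E₀ ≤ -(C * (Real.log CL + 5 * ℓ + 2 * A * d)) := by
    have : C * (2 * A * d) = 2 * A * C * d := by ring
    rw [hE₀]; linarith [hd, this]
  -- (ii) the main term
  have hAη : η * ℓ ^ 3 / 24 ≤ A * η := by
    have h4 := sfi_pow_four_div_le_exp hℓpos.le
    rw [hA, hL]
    rw [show Real.exp ℓ / ℓ * η = (Real.exp ℓ * η) / ℓ by ring, le_div_iff₀ hℓpos]
    have : ℓ ^ 4 / 24 * η ≤ Real.exp ℓ * η := mul_le_mul_of_nonneg_right h4 hη.le
    have hring : η * ℓ ^ 3 / 24 * ℓ = ℓ ^ 4 / 24 * η := by ring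
    linarith [this, hring]
  have hii_exp : Real.log (2 * CL) + 3 * ℓ - A * η ≤ E₀ - Real.log 2 := by
    have h1 : Q₁ ≤ η * ℓ ^ 3 / 64 := by
      have h64 : 64 * Q₁ ≤ ℓ * η := by rwa [div_le_iff₀ hη] at hℓQ₁
      have hℓ2 : 1 ≤ ℓ ^ 2 := one_le_pow₀ hℓ1
      have : 64 * Q₁ * 1 ≤ (ℓ * η) * ℓ ^ 2 :=
        mul_le_mul h64 hℓ2 zero_le_one (by positivity)
      have hring : (ℓ * η) * ℓ ^ 2 = η * ℓ ^ 3 := by ring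
      linarith [this, hring]
    have h2 : (3 + 5 * C) * ℓ ≤ η * ℓ ^ 3 / 64 := by
      have h64 : 64 * (3 + 5 * C) ≤ ℓ * η := by rwa [div_le_iff₀ hη] at hℓC
      have : 64 * (3 + 5 * C) * ℓ ≤ (ℓ * η) * ℓ ^ 2 := by
        have hℓℓ : ℓ ≤ ℓ ^ 2 := le_self_pow₀ hℓ1 two_ne_zero
        exact mul_le_mul h64 hℓℓ hℓpos.le (by positivity)
      have hring : (ℓ * η) * ℓ ^ 2 = η * ℓ ^ 3 := by ring
      linarith [this, hring]
    rw [hE₀]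
    linarith [h1, h2, hAη, hQ₁def]
  have hii : CL * ((L ^ 3 + 1) * Real.exp (-(A * η))) ≤ Real.exp E₀ / 2 := by
    have hL3 : 1 ≤ L ^ 3 := one_le_pow₀ hL1
    have hstep1 : CL * ((L ^ 3 + 1) * Real.exp (-(A * η))) ≤
        2 * CL * L ^ 3 * Real.exp (-(A * η)) := by
      have hpos : 0 ≤ CL * Real.exp (-(A * η)) := by positivity
      have : L ^ 3 + 1 ≤ 2 * L ^ 3 := by linarith
      calc CL * ((L ^ 3 + 1) * Real.exp (-(A * η)))
          = (CL * Real.exp (-(A * η))) * (L ^ 3 + 1) := by ring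
        _ ≤ (CL * Real.exp (-(A * η))) * (2 * L ^ 3) := mul_le_mul_of_nonneg_left this hpos
        _ = 2 * CL * L ^ 3 * Real.exp (-(A * η)) := by ring
    have hstep2 : 2 * CL * L ^ 3 * Real.exp (-(A * η)) =
        Real.exp (Real.log (2 * CL) + 3 * ℓ - A * η) := by
      rw [sub_eq_add_neg, Real.exp_add, Real.exp_add, Real.exp_log (by positivity), hL,
        ← Real.exp_nat_mul]
      push_cast
      ring
    have hstep3 : Real.exp (Real.log (2 * CL) + 3 * ℓ - A * η) ≤ Real.exp (E₀ - Real.log 2) :=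
      Real.exp_le_exp.2 hii_exp
    have hstep4 : Real.exp (E₀ - Real.log 2) = Real.exp E₀ / 2 := by
      rw [Real.exp_sub, Real.exp_log two_pos]
    linarith [hstep1, hstep2, hstep3, hstep4]
  -- (iii) the `T^{-1/4}` term
  have hiii_exp : Real.log CL - L / 4 ≤ E₀ - Real.log 2 := by
    have hAηL : A * η ≤ L / 2 := by
      rw [hA, div_mul_eq_mul_div, div_le_iff₀ hℓpos]
      have := mul_le_mul_of_nonneg_left hℓη hLpos.le
      linarith [this]
    have hL2 : ℓ ^ 2 / 2 ≤ L := by rw [hL]; exact sfi_sq_div_two_le_exp hℓpos.le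
    have h1 : Q₂ ≤ ℓ ^ 2 / 32 := by
      have : 32 * Q₂ * 1 ≤ ℓ * ℓ := mul_le_mul hℓQ₂ hℓ1 zero_le_one hℓpos.le
      have hring : ℓ * ℓ = ℓ ^ 2 := by ring
      linarith [this, hring]
    have h2 : 5 * C * ℓ ≤ ℓ ^ 2 / 32 := by
      have : 160 * C * ℓ ≤ ℓ * ℓ := mul_le_mul_of_nonneg_right hℓ160 hℓpos.le
      have hring : ℓ * ℓ = ℓ ^ 2 := by ring
      linarith [this, hring]
    rw [hE₀]
    linarith [hQ₂def, h1, h2, hL2, hAηL]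
  have hiii : CL * Real.exp (-(L / 4)) ≤ Real.exp E₀ / 2 := by
    have heq : CL * Real.exp (-(L / 4)) = Real.exp (Real.log CL - L / 4) := by
      rw [sub_eq_add_neg, Real.exp_add, Real.exp_log hCL]
    rw [heq]
    calc Real.exp (Real.log CL - L / 4) ≤ Real.exp (E₀ - Real.log 2) := Real.exp_le_exp.2 hiii_exp
      _ = Real.exp E₀ / 2 := by rw [Real.exp_sub, Real.exp_log two_pos]
  -- combine
  calc CL * ((L ^ 3 + 1) * Real.exp (-(A * η)) + Real.exp (-(L / 4)))
      = CL * ((L ^ 3 + 1) * Real.exp (-(A * η))) + CL * Real.exp (-(L / 4)) := by ring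
    _ ≤ Real.exp E₀ / 2 + Real.exp E₀ / 2 := add_le_add hii hiii
    _ = Real.exp E₀ := by ring
    _ ≤ Real.exp (-(C * (Real.log CL + 5 * ℓ + 2 * A * d))) := Real.exp_le_exp.2 htarget

set_option maxHeartbeats 1000000 in
/-- **`StepFromInverse`** (route item stmt-RiemannHypothesis-17860): the budgeted two-sided
inverse theorem and the local explicit formula give the zero-chain step, with `a = 2K`,
`b = 6K`, `D = min(η, η/(8C), 1/(8KC_L))`. [this work] -/
theorem stepFromInverse_proof : StepFromInverse := by
  rintro ⟨C, hC, K, hK, B₀, hX⟩ ⟨w, hw1, hw2, hw3, hw4, CL, hCL, T₁, hLoc⟩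
  refine ⟨2 * K, by positivity, 6 * K, by positivity, w, hw1, hw2, hw3, hw4, ?_⟩
  intro η hη
  -- depth allowance
  set D : ℝ := min η (min (η / (8 * C)) (1 / (8 * K * CL))) with hD_def
  have hDη : D ≤ η := min_le_left _ _
  have hDC : D ≤ η / (8 * C) := le_trans (min_le_right _ _) (min_le_left _ _)
  have hDK : D ≤ 1 / (8 * K * CL) := le_trans (min_le_right _ _) (min_le_right _ _)
  have hD0 : 0 < D := lt_min hη (lt_min (by positivity) (by positivity))
  -- thresholds on `ℓ = loglog T`
  set Q₁ : ℝ := max 0 (Real.log (2 * CL) + Real.log 2 + C * Real.log CL) with hQ₁_def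
  set Q₂ : ℝ := max 0 (Real.log 2 + Real.log CL + C * Real.log CL) with hQ₂_def
  have hQ₁0 : 0 ≤ Q₁ := le_max_left _ _
  have hQ₂0 : 0 ≤ Q₂ := le_max_left _ _
  have hQ₁def : Real.log (2 * CL) + Real.log 2 + C * Real.log CL ≤ Q₁ := le_max_right _ _
  have hQ₂def : Real.log 2 + Real.log CL + C * Real.log CL ≤ Q₂ := le_max_right _ _
  set M : ℝ := max 1 (max (2 * η) (max (B₀ / CL) (max (1 / CL) (max (Real.log CL)
    (max (144 * K * CL) (max (64 * Q₁ / η) (max (64 * (3 + 5 * C) / η)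
    (max (32 * Q₂) (160 * C))))))))) with hM_def
  refine ⟨D, hD0, hDη, max T₁ (Real.exp (Real.exp M)), ?_⟩
  intro T hTge hHYP ρ₀ hζ₀ hre₀ him₁ him₂ hapex ρ hζ d hd0 hdD hre habsim
  -- unpack the thresholds
  have hT₁ : T₁ ≤ T := le_trans (le_max_left _ _) hTge
  have hTexp : Real.exp (Real.exp M) ≤ T := le_trans (le_max_right _ _) hTge
  have hTpos : 0 < T := lt_of_lt_of_le (Real.exp_pos _) hTexp
  set L : ℝ := Real.log T with hL_def
  have hLM : Real.exp M ≤ L := by rw [hL_def, Real.le_log_iff_exp_le hTpos]; exact hTexp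
  have hLpos : 0 < L := lt_of_lt_of_le (Real.exp_pos _) hLM
  set ℓ : ℝ := Real.log L with hℓ_def
  have hℓM : M ≤ ℓ := by rw [hℓ_def, Real.le_log_iff_exp_le hLpos]; exact hLM
  have hm1 : 1 ≤ ℓ := le_trans (le_max_left _ _) hℓM
  have hr1 := le_trans (le_max_right _ _) hℓM
  have hm2 : 2 * η ≤ ℓ := le_trans (le_max_left _ _) hr1
  have hr2 := le_trans (le_max_right _ _) hr1
  have hm3 : B₀ / CL ≤ ℓ := le_trans (le_max_left _ _) hr2
  have hr3 := le_trans (le_max_right _ _) hr2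
  have hm4 : 1 / CL ≤ ℓ := le_trans (le_max_left _ _) hr3
  have hr4 := le_trans (le_max_right _ _) hr3
  have hm5 : Real.log CL ≤ ℓ := le_trans (le_max_left _ _) hr4
  have hr5 := le_trans (le_max_right _ _) hr4
  have hm6 : 144 * K * CL ≤ ℓ := le_trans (le_max_left _ _) hr5
  have hr6 := le_trans (le_max_right _ _) hr5
  have hm7 : 64 * Q₁ / η ≤ ℓ := le_trans (le_max_left _ _) hr6
  have hr7 := le_trans (le_max_right _ _) hr6
  have hm8 : 64 * (3 + 5 * C) / η ≤ ℓ := le_trans (le_max_left _ _) hr7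
  have hr8 := le_trans (le_max_right _ _) hr7
  have hm9 : 32 * Q₂ ≤ ℓ := le_trans (le_max_left _ _) hr8
  have hm10 : 160 * C ≤ ℓ := le_trans (le_max_right _ _) hr8
  have hℓpos : 0 < ℓ := by linarith
  have hLexp : Real.exp ℓ = L := by rw [hℓ_def, Real.exp_log hLpos]
  have hLℓ : ℓ + 1 ≤ L := by rw [← hLexp]; exact Real.add_one_le_exp ℓ
  have hL1 : 1 ≤ L := by linarith
  -- `A = L/ℓ`
  set A : ℝ := L / ℓ with hA_def
  have hApos : 0 < A := div_pos hLpos hℓpos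
  have hA2 : 2 * A = 2 * Real.log T / Real.log (Real.log T) := by
    show 2 * (L / ℓ) = 2 * L / ℓ
    ring
  -- facts about `ρ`
  have hre1 : ρ.re < 1 := by
    by_contra h
    push Not at h
    exact riemannZeta_ne_zero_of_one_le_re h hζ
  have hreη : 1 / 2 + η ≤ ρ.re := by linarith
  have hre12 : 1 / 2 ≤ ρ.re := by linarith
  have himρ₁ : T ≤ ρ.im := by have := (abs_le.1 habsim).1; linarith
  have himρ₂ : ρ.im ≤ 2 * T := by have := (abs_le.1 habsim).2; linarith
  -- the local power sum at `ρ`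
  obtain ⟨S, c, hS0, hc0, hSz, hmass, hpos, hbound⟩ := hLoc T hT₁ ρ hζ hre12 himρ₁ himρ₂
  -- the budget `B`
  set B : ℝ := CL * L ^ 5 * Real.exp (2 * A * d) with hB_def
  have hBpos : 0 < B := by positivity
  have hlogB : Real.log B = Real.log CL + 5 * ℓ + 2 * A * d := by
    rw [hB_def, Real.log_mul (by positivity) (Real.exp_pos _).ne', Real.log_mul hCL.ne' (by positivity),
      Real.log_exp, Real.log_pow]
    push_cast
    ring
  have hB₀B : B₀ ≤ B := by
    have h1 : B₀ ≤ CL * ℓ := by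
      have := hm3; rwa [div_le_iff₀ hCL, mul_comm] at this
    have h2 : CL * ℓ ≤ CL * L := mul_le_mul_of_nonneg_left (by linarith) hCL.le
    have h3 : CL * L ≤ B := by
      have hL5 : L ≤ L ^ 5 := le_self_pow₀ hL1 (by norm_num)
      have he : 1 ≤ Real.exp (2 * A * d) := Real.one_le_exp (by positivity)
      calc CL * L = CL * L * 1 := by ring
        _ ≤ CL * L ^ 5 * Real.exp (2 * A * d) := by gcongr
    linarith
  -- the flank `g = K log B / A`
  set g : ℝ := K * Real.log B / A with hg_def
  have hg_eq : g = 2 * K * d + K * (Real.log CL + 5 * ℓ) * ℓ / L := by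
    rw [hg_def, hlogB, hA_def]
    field_simp
    ring
  have hL3 : ℓ ^ 3 / 6 ≤ L := by rw [← hLexp]; exact sfi_cube_div_six_le_exp hℓpos.le
  have hℓ2L : ℓ ^ 2 / L ≤ 6 / ℓ := by
    rw [div_le_div_iff₀ hLpos hℓpos]
    have hring : ℓ ^ 2 * ℓ = ℓ ^ 3 := by ring
    linarith [hL3, hring]
  have hg1 : g ≤ 2 * K * d + 6 * K * ℓ ^ 2 / L := by
    rw [hg_eq]
    have : K * (Real.log CL + 5 * ℓ) * ℓ / L ≤ 6 * K * ℓ ^ 2 / L := by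
      apply div_le_div_of_nonneg_right _ hLpos.le
      have h6 : K * (Real.log CL + 5 * ℓ) ≤ K * (6 * ℓ) :=
        mul_le_mul_of_nonneg_left (by linarith) hK.le
      calc K * (Real.log CL + 5 * ℓ) * ℓ ≤ K * (6 * ℓ) * ℓ :=
            mul_le_mul_of_nonneg_right h6 hℓpos.le
        _ = 6 * K * ℓ ^ 2 := by ring
    linarith
  have hflank : 6 * K * ℓ ^ 2 / L ≤ 1 / (4 * CL) := by
    have h1 : 6 * K * ℓ ^ 2 / L ≤ 36 * K / ℓ := by
      calc 6 * K * ℓ ^ 2 / L = 6 * K * (ℓ ^ 2 / L) := by ring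
        _ ≤ 6 * K * (6 / ℓ) := by gcongr
        _ = 36 * K / ℓ := by ring
    have h2 : 36 * K / ℓ ≤ 1 / (4 * CL) := by
      rw [div_le_div_iff₀ hℓpos (by positivity)]
      have hring : 36 * K * (4 * CL) = 144 * K * CL := by ring
      linarith [hm6, hring]
    linarith
  have hg_le : g ≤ 1 / CL := by
    have h2Kd : 2 * K * d ≤ 1 / (4 * CL) := by
      have hd' : d ≤ 1 / (8 * K * CL) := le_trans hdD hDK
      calc 2 * K * d ≤ 2 * K * (1 / (8 * K * CL)) := by gcongr
        _ = 1 / (4 * CL) := by field_simp; ring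
    have hsum : 1 / (4 * CL) + 1 / (4 * CL) ≤ 1 / CL := by
      rw [← add_div, div_le_div_iff₀ (by positivity) hCL]
      linarith [hCL]
    linarith [hg1, hflank]
  -- apply the inverse theorem to the configuration `(r − ρ, c r)_{r ∈ S}`
  have hbudget : ∑ r ∈ S, ‖c r‖ * max 1 (Real.exp (2 * A * ((fun r : ℂ => r - ρ) r).re)) ≤ B := by
    have hW : ∀ r ∈ S, max 1 (Real.exp (2 * A * ((fun r : ℂ => r - ρ) r).re)) ≤
        L ^ 2 * Real.exp (2 * A * d) := by
      intro r hr
      obtain ⟨hζr, himr⟩ := hSz r hr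
      have hwin : |r.im - ρ₀.im| ≤ Real.log T ^ 2 := by
        have h1 := abs_le.1 himr
        have h2 := abs_le.1 habsim
        have hL2 : (1 : ℝ) ≤ L ^ 2 := one_le_pow₀ hL1
        show |r.im - ρ₀.im| ≤ L ^ 2
        rw [abs_le]
        constructor <;> linarith [h1.1, h1.2, h2.1, h2.2, hL2]
      have hapr := hapex r hζr hwin
      have he1 : 1 ≤ Real.exp (2 * A * d) := Real.one_le_exp (by positivity)
      have hL2 : (1 : ℝ) ≤ L ^ 2 := one_le_pow₀ hL1
      refine max_le ?_ ?_
      · exact one_le_mul_of_one_le_of_one_le hL2 he1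
      · have hz : r.re - ρ.re ≤ d + ℓ ^ 2 / L := by
          have : r.re ≤ ρ₀.re + ℓ ^ 2 / L := hapr
          linarith
        show Real.exp (2 * A * (r - ρ).re) ≤ L ^ 2 * Real.exp (2 * A * d)
        rw [Complex.sub_re]
        calc Real.exp (2 * A * (r.re - ρ.re)) ≤ Real.exp (2 * A * (d + ℓ ^ 2 / L)) := by
              apply Real.exp_le_exp.2
              exact mul_le_mul_of_nonneg_left hz (by positivity)
          _ = Real.exp (2 * A * d) * Real.exp (2 * ℓ) := by
              rw [← Real.exp_add]
              congr 1
              rw [hA_def]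
              field_simp
          _ = L ^ 2 * Real.exp (2 * A * d) := by
              rw [show (2 : ℝ) * ℓ = ((2 : ℕ) : ℝ) * ℓ by norm_num, Real.exp_nat_mul, hLexp]
              ring
    calc ∑ r ∈ S, ‖c r‖ * max 1 (Real.exp (2 * A * ((fun r : ℂ => r - ρ) r).re))
        ≤ ∑ r ∈ S, ‖c r‖ * (L ^ 2 * Real.exp (2 * A * d)) :=
          Finset.sum_le_sum fun r hr => mul_le_mul_of_nonneg_left (hW r hr) (norm_nonneg _)
      _ = (∑ r ∈ S, ‖c r‖) * (L ^ 2 * Real.exp (2 * A * d)) := by rw [Finset.sum_mul]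
      _ ≤ (CL * L ^ 3) * (L ^ 2 * Real.exp (2 * A * d)) :=
          mul_le_mul_of_nonneg_right hmass (by positivity)
      _ = B := by rw [hB_def]; ring
  have hposX : ∀ r ∈ S, ‖(fun r : ℂ => r - ρ) r‖ ≤ K * Real.log B / A → |(c r).arg| ≤ 1 / 10 := by
    intro r hr hnorm
    exact hpos r hr (le_trans hnorm hg_le)
  have hsmall : ∀ t ∈ Set.Icc A (2 * A),
      ‖∑ r ∈ S, c r * Complex.exp ((t : ℂ) * (fun r : ℂ => r - ρ) r)‖ ≤ B ^ (-C) := by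
    intro t ht
    obtain ⟨ht1, ht2⟩ := ht
    have ht0 : 0 < t := lt_of_lt_of_le hApos ht1
    have ht2' : t ≤ 2 * Real.log T / Real.log (Real.log T) := by rw [← hA2]; exact ht2
    -- the local bound at `u = t`
    have hb := hbound t ht1 ht2'
    -- the prime-sum hypothesis at `s = ρ`, `U = e^t`
    have hU1 : 1 < Real.exp t := by
      have := Real.add_one_le_exp t
      linarith
    have hlogU : Real.log (Real.exp t) = t := Real.log_exp t
    have hH := hHYP ρ hreη hre1.le himρ₁ himρ₂ (Real.exp t) hU1 (by rw [hlogU]; exact ht1)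
      (by rw [hlogU]; exact ht2')
    have hexp1 : Real.exp t ^ (1 / 2 - ρ.re) ≤ Real.exp (-(A * η)) := by
      rw [← Real.exp_mul]
      apply Real.exp_le_exp.2
      have h1 : t * (1 / 2 - ρ.re) ≤ t * (-η) := mul_le_mul_of_nonneg_left (by linarith) ht0.le
      have h2 : t * (-η) ≤ A * (-η) := mul_le_mul_of_nonpos_right ht1 (by linarith)
      linarith
    have hT4 : T ^ (-(1 / 4 : ℝ)) = Real.exp (-(L / 4)) := by
      rw [Real.rpow_def_of_pos hTpos]
      congr 1
      show Real.log T * (-(1 / 4 : ℝ)) = -(L / 4)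
      ring
    have hF : ‖∑ r ∈ S, c r * Complex.exp ((t : ℂ) * (r - ρ))‖ ≤
        CL * ((L ^ 3 + 1) * Real.exp (-(A * η)) + Real.exp (-(L / 4))) := by
      refine le_trans hb ?_
      rw [hT4]
      apply mul_le_mul_of_nonneg_left _ hCL.le
      have hL3pos : (0 : ℝ) ≤ L ^ 3 := by positivity
      have hS_le : ‖∑' n : ℕ, ((ArithmeticFunction.vonMangoldt n : ℝ) : ℂ) *
          ((w ((n : ℝ) / Real.exp t) : ℝ) : ℂ) * (n : ℂ) ^ (-ρ)‖ ≤ Real.exp (-(A * η)) * L ^ 3 :=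
        le_trans hH (mul_le_mul_of_nonneg_right hexp1 hL3pos)
      linarith [hS_le, hexp1]
    have hBC : B ^ (-C) = Real.exp (-(C * Real.log B)) := by
      rw [Real.rpow_def_of_pos hBpos]
      congr 1
      ring
    rw [hBC, hlogB]
    refine le_trans hF ?_
    have hd' : 2 * A * C * d ≤ A * η / 4 := by
      have hdC : d ≤ η / (8 * C) := le_trans hdD hDC
      have : 2 * A * C * d ≤ 2 * A * C * (η / (8 * C)) :=
        mul_le_mul_of_nonneg_left hdC (by positivity)
      calc 2 * A * C * d ≤ 2 * A * C * (η / (8 * C)) := this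
        _ = A * η / 4 := by field_simp; ring
    exact sfi_smallness hC hCL hη hm1 hm2 hQ₁def hQ₂def hm7 hm8 hm9 hm10 hLexp.symm
      hA_def hd'
  obtain ⟨⟨r, hrS, hr1, hr2, hr3⟩, -⟩ :=
    hX ℂ S (fun r : ℂ => r - ρ) c A B hApos hB₀B ⟨ρ, hS0, by simp, hc0⟩ hbudget hposX hsmall
  simp only [Complex.sub_im, Complex.sub_re] at hr1 hr2 hr3
  have hg2 : g ≤ 2 * K * d + 6 * K * Real.log (Real.log T) ^ 2 / Real.log T := hg1
  have hr2' : r.im - ρ.im ≤ g := hr2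
  have hr3' : -g ≤ r.re - ρ.re := hr3
  refine ⟨r, (hSz r hrS).1, by linarith, ?_, ?_⟩
  · linarith
  · linarith

/-- The registered stub `stub_stepFromInverse` of the skeleton
`Cruxes/ClusterForcing/Lines/step_from_inverse.lean` (piece stmt-RiemannHypothesis-17850). [this work] -/
theorem stub_stepFromInverse : StepFromInverse := stepFromInverse_proof

end Summit.RiemannHypothesis.RiemannHypothesis.Theorems
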